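import Literature.IUT.HodgeTheaters.GoodLocalFrobenioidKindFunctors
import Literature.IUT.HodgeTheaters.GoodLocalFrobenioidBasesKindFunctors
import HarnessLib

/-!
# [IUTchI] Example 3.3 (iii): the two routes `ℱ̲_v ↦ 𝒟_v ↦ 𝒟⊢_v` and `ℱ̲_v ↦ 𝒞⊢_v ↦ 𝒟⊢_v` AGREE on isomorphisms of
# categories — abc-iut-L5-t2's LAW `baseCompat` for the one-object kinds, generically and AT THE GENUINE PLACE

S. Mochizuki, *Inter-universal Teichmüller theory I*, kurims manuscript (May 2020), §0 p. 33 ("isomorphism of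
categories" = isomorphism class of equivalences); Example 3.3 (i) p. 78 ("`𝒞⊢_v ⊆ 𝒞_v` … in a fashion compatible
with the natural inclusion `𝒟⊢_v ⊆ 𝒟_v`"); Example 3.3 (iii) (a)–(d) p. 79; Definition 3.6 / Corollary 3.7 (ii) (a
Θ-Hodge theater's passages `ℱ̲_v ↦ 𝒟_v ↦ 𝒟⊢_v` and `ℱ̲_v ↦ ℱ⊢_v ↦ 𝒟⊢_v`) ([IUTchI] Ex 3.3 (iii) p.79)
[claim: Mochizuki2012, status: disputed] (D-0012 claim key, status DISPUTED — nothing of the series is asserted; no side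
is taken on [IUTchIII] Cor. 3.12).

WHY.  abc-iut-L5-t2's interface `HodgeTheaterModel D` (`ThetaHodgeTheaters.lean`) carries the LAW
`baseCompat v : baseFullOf v ⋙ dashOfBase v ≅ dashOf v ⋙ base v` (t2's docstring: "the two routes `ℱ̲_v ↦ 𝒟_v ↦ 𝒟⊢_v`
and `ℱ̲_v ↦ ℱ⊢_v ↦ 𝒟⊢_v` agree").  In design F1 of the «genuine ℱ-prime-strip kit» hub (abc-iut-L5-t4: kinds :=
`SingleObj (CatAut −)`) the four slot functors at a good nonarchimedean place are now in tree as §0 kind functors — (c)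
`𝒞_v ↦ 𝒟_v` = abc-iut-L5-t4's `kindFunctor` over abc-iut-w4-d109's `hasUnder_toBase_ofGalois` / `underUnique_toBase_ofGalois`
(p491065, p493980); (a) `𝒟_v ↦ 𝒟⊢_v` = `ddashKindFunctor`, (d) `𝒞_v ↦ 𝒞⊢_v` = `cdashKindFunctor` (this seat, p496061);
(b) `𝒞⊢_v ↦ 𝒟⊢_v` = `kindFunctor` over `hasUnder_cdashBase_ofGalois` / `underUnique_cdashBase_ofGalois` (this seat,
p496475).  This file (seat abc-iut-w4-d047 gen 9; hub row R44 «E33III-ON-ISOS» FILE 4 «BASECOMPAT») PROVES the law for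
them:

* §1 (any `G : GoodLocalFrobenioid p K_v`, over the six binders) — `liesUnder_cdashBase_of_routes`: if `Θ` lies under
  `Ψ` (w.r.t. `toBase`), `Θ'` lifts `Θ` (along `incl`) and `Ψ'` lifts `Ψ` (along `CdashToC`), then `Θ'` lies under `Ψ'`
  w.r.t. `CdashBase` — by pasting abc-iut-L5-t2's compatibility field `CdashToC_base : CdashToC ⋙ toBase ≅ CdashBase ⋙ incl`
  and CANCELLING the fully faithful `incl` on the right (Mathlib `Functor.fullyFaithfulCancelRight`); hence
  `descend_cdashAscend_eq_ddashAscend_descend` (equality of the two composite homomorphisms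
  `Aut(𝒞_v) → Aut(𝒟⊢_v)`) and the natural isomorphism of composite kind functors `baseCompatKindFunctors`;
* §2 AT THE FINITE PLACE `v̲ = w ∣ p` of the initial Θ-datum (`goodLocalFrobenioidAt`, `K_v̲ := K_w`): the (c) binders
  discharged from the slimness of `Δ_C` (`hΔC`, FACT F-0004 first conjunct — abc-iut-w4-d109's group form +
  `isSlimGroup_PiLoc_PiXarrow_of_geom_slim`), the (c) kind functor `InitialThetaData.toBaseKindFunctorAt (hX) (hΔC)`, and
  **`InitialThetaData.baseCompatAt (hX) (hΔC) (hΔ) :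
  toBaseKindFunctorAt ⋙ ddashKindFunctorAt ≅ cdashKindFunctorAt ⋙ cdashBaseKindFunctorAt`** — t2's `baseCompat v` AT THE
  GENUINE good place with displayed binders EXACTLY {Galois-countability, `hX`, `hΔC`, `hΔ` (FACT F-0007 shape)}.

0 new `Prop` fact, 0 instance, 0 notation, nothing restated; typed ≠ inhabited ≠ proved.
-/

noncomputable section

namespace Literature.IUT.HodgeTheaters

open CategoryTheory Literature.AnabelianGeometry.SemiGraphs Literature.AlgebraicGeometry.Frobenioids
open Literature.AlgebraicGeometry.Frobenioids.PadicFrd Literature.AnabelianGeometry.AbsoluteAnabelian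
open Literature.NumberTheory.NumberFields IsDedekindDomain NumberField

universe u

namespace GoodLocalFrobenioid

/-! ### §1. The law for any inhabitant of the Ex. 3.3 interface, over the six binders -/

section Generic

variable {p : ℕ} {Kv : Type} [Field Kv] [ValuativeRel Kv] (G : GoodLocalFrobenioid.{u} p Kv)

/-- **Pasting lemma**: if `Θ` lies under `Ψ : 𝒞_v ⥲ 𝒞_v` (w.r.t. `toBase`), `Θ' : 𝒟⊢_v ⥲ 𝒟⊢_v` lifts `Θ` along
`incl : 𝒟⊢_v ⊆ 𝒟_v` and `Ψ' : 𝒞⊢_v ⥲ 𝒞⊢_v` lifts `Ψ` along `𝒞⊢_v ⊆ 𝒞_v`, then `Θ'` lies under `Ψ'` w.r.t. `CdashBase` —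
the square `Ψ' ⋙ CdashBase ⋙ incl ≅ CdashBase ⋙ Θ' ⋙ incl` is assembled from the three given squares and abc-iut-L5-t2's
compatibility `CdashToC ⋙ toBase ≅ CdashBase ⋙ incl` (Ex. 3.3 (i)), and the fully faithful `incl` is cancelled on the
right. ([IUTchI] Ex 3.3 (iii) p.79) [claim: Mochizuki2012, status: disputed] -/
def liesUnderCdashBaseOfRoutes {Ψ : G.Cv ≌ G.Cv} {Θ : G.Dv ≌ G.Dv} {Ψ' : G.Cdash ≌ G.Cdash} {Θ' : G.Ddash ≌ G.Ddash}
    (h : CatIsomorphism.LiesUnder G.toBase G.toBase Ψ Θ) (i : CatIsomorphism.LiesUnder G.incl G.incl Θ' Θ)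
    (j : CatIsomorphism.LiesUnder G.CdashToC G.CdashToC Ψ' Ψ) :
    CatIsomorphism.LiesUnder G.CdashBase G.CdashBase Ψ' Θ' :=
  let cb : G.CdashToC ⋙ G.toBase ≅ G.CdashBase ⋙ G.incl := G.CdashToC_base.some
  Functor.fullyFaithfulCancelRight G.incl
    (Functor.associator Ψ'.functor G.CdashBase G.incl ≪≫ Functor.isoWhiskerLeft Ψ'.functor cb.symm ≪≫
      (Functor.associator Ψ'.functor G.CdashToC G.toBase).symm ≪≫ Functor.isoWhiskerRight j G.toBase ≪≫
      Functor.associator G.CdashToC Ψ.functor G.toBase ≪≫ Functor.isoWhiskerLeft G.CdashToC h ≪≫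
      (Functor.associator G.CdashToC G.toBase Θ.functor).symm ≪≫ Functor.isoWhiskerRight cb Θ.functor ≪≫
      Functor.associator G.CdashBase G.incl Θ.functor ≪≫ Functor.isoWhiskerLeft G.CdashBase i.symm ≪≫
      (Functor.associator G.CdashBase Θ'.functor G.incl).symm)

/-- Propositional form of the pasting lemma. ([IUTchI] Ex 3.3 (iii) p.79) [claim: Mochizuki2012, status: disputed] -/
theorem liesUnder_cdashBase_of_routes {Ψ : G.Cv ≌ G.Cv} {Θ : G.Dv ≌ G.Dv} {Ψ' : G.Cdash ≌ G.Cdash}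
    {Θ' : G.Ddash ≌ G.Ddash} (h : Nonempty (CatIsomorphism.LiesUnder G.toBase G.toBase Ψ Θ))
    (i : Nonempty (CatIsomorphism.LiesUnder G.incl G.incl Θ' Θ))
    (j : Nonempty (CatIsomorphism.LiesUnder G.CdashToC G.CdashToC Ψ' Ψ)) :
    Nonempty (CatIsomorphism.LiesUnder G.CdashBase G.CdashBase Ψ' Θ') := by
  obtain ⟨h⟩ := h
  obtain ⟨i⟩ := i
  obtain ⟨j⟩ := j
  exact ⟨G.liesUnderCdashBaseOfRoutes h i j⟩

variable (heB : CatIsomorphism.HasUnder G.toBase G.toBase) (huB : CatIsomorphism.UnderUnique G.toBase G.toBase)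
  (ha : G.DdashFromD) (hd : G.CdashFromF) (hud : CatIsomorphism.LiftUnique G.CdashToC G.CdashToC)
  (heD : CatIsomorphism.HasUnder G.CdashBase G.CdashBase) (huD : CatIsomorphism.UnderUnique G.CdashBase G.CdashBase)

/-- **The two routes agree on `Aut(−)`**: for every isomorphism class `a ∈ Aut(𝒞_v)`, descending `a` to `Aut(𝒟_v)`
((c), abc-iut-L5-t4's `descendHom`) and lifting to `Aut(𝒟⊢_v)` ((a), `ddashAscendHom`) gives the same class as lifting
`a` to `Aut(𝒞⊢_v)` ((d), `cdashAscendHom`) and descending to `Aut(𝒟⊢_v)` ((b), `descendHom`) — over the six displayed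
binders of the four natural maps. ([IUTchI] Ex 3.3 (iii) p.79) [claim: Mochizuki2012, status: disputed] -/
theorem descend_cdashAscend_eq_ddashAscend_descend (a : CatAut G.Cv) :
    CatIsomorphism.descendHom heD huD (G.cdashAscendHom hd hud a) =
      G.ddashAscendHom ha (CatIsomorphism.descendHom heB huB a) := by
  obtain ⟨Ψ, rfl⟩ := CatIsomorphism.mk_surjective a
  obtain ⟨Θ, h⟩ := heB Ψ
  obtain ⟨Θ', i⟩ := G.hasLift_incl_of_ddashFromD ha Θ
  obtain ⟨Ψ', j⟩ := G.hasLift_cdashToC_of_cdashFromF hd Ψ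
  rw [CatIsomorphism.descendHom_apply, CatIsomorphism.descendHom_apply, CatIsomorphism.descend_mk heB huB h,
    G.ddashAscendHom_mk ha i.some.symm, G.cdashAscendHom_mk hd hud j.some.symm]
  exact CatIsomorphism.descend_mk heD huD (G.liesUnder_cdashBase_of_routes h i j)

/-- **abc-iut-L5-t2's LAW `baseCompat` for the one-object kinds of `G`** (design F1): the composite kind functors
`𝒞_v ↦ 𝒟_v ↦ 𝒟⊢_v` and `𝒞_v ↦ 𝒞⊢_v ↦ 𝒟⊢_v` are naturally isomorphic (indeed equal on morphisms,
`descend_cdashAscend_eq_ddashAscend_descend`), over the six binders. ([IUTchI] Ex 3.3 (iii) p.79) [claim: Mochizuki2012, status: disputed] -/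
def baseCompatKindFunctors :
    CatIsomorphism.kindFunctor heB huB ⋙ G.ddashKindFunctor ha ≅
      G.cdashKindFunctor hd hud ⋙ CatIsomorphism.kindFunctor heD huD :=
  NatIso.ofComponents (fun _ => Iso.refl _) fun f => by
    simp only [Functor.comp_map, Iso.refl_hom, SingleObj.id_as_one, SingleObj.comp_as_mul,
      mul_one, one_mul]
    exact (G.descend_cdashAscend_eq_ddashAscend_descend heB huB ha hd hud heD huD f).symm

end Generic

end GoodLocalFrobenioid

/-! ### §2. At the printed object `goodLocalFrobenioidOfEmb` and AT THE FINITE PLACE `v̲ = w ∣ p` -/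

section Datum

variable {F : Type u} {K : Type} {Fbar : Type} [Field F] [NumberField F] [Field K] [NumberField K]
  [Algebra F K] [Field Fbar] [Algebra F Fbar] [Algebra K Fbar] [IsScalarTower F K Fbar] [Normal K Fbar]
  {E : WeierstrassCurve F} [E.IsElliptic] {l : ℕ} {Pb : BadPlacePredicates K}
  (D : InitialThetaData F K Fbar E l Pb) (p : ℕ) [Fact p.Prime]
  (k : Type) [NontriviallyNormedField k] [CompleteSpace k] [IsUltrametricDist k] [NormedAlgebra ℚ_[p] k]
  [FiniteDimensional ℚ_[p] k] [Algebra K k]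

namespace InitialThetaData

/-- **Both binders of the natural map `Aut(𝒞_v̲) → Aut(𝒟_v̲)` ((c), `toBase`) AT THE PRINTED OBJECT**
`goodLocalFrobenioidOfEmb` (`K_v̲ = k`, `Π_v̲ := Π_{X̲→_K} ×_{G_K} Gal(k̄/k)` along `ι`), modulo ONLY the slimness of
`Δ_C` (`hΔC`, [AbsAnab] Lem. 1.3.1 = FACT F-0004 first conjunct): `Π_v̲` is then slim
(`isSlimGroup_PiLoc_PiXarrow_of_geom_slim`, `G_v̲` slim being a tree theorem) and abc-iut-w4-d109's group form
`hasUnder_and_underUnique_toBase_ofGalois_of_isSlimGroup` applies. ([IUTchI] Ex 3.3 (iii) (c) p.79) [claim: Mochizuki2012, status: disputed] -/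
theorem hasUnder_and_underUnique_toBase_goodLocalFrobenioidOfEmb (ι : Fbar →ₐ[K] AlgebraicClosure k)
    (hX : IsOpen (D.PiXarrow : Set D.PiC)) (hΔC : IsSlimGroup D.DeltaC) :
    CatIsomorphism.HasUnder
        (@GoodLocalFrobenioid.toBase p k _ (GaloisValDatum.normVal k) (D.goodLocalFrobenioidOfEmb p k ι hX))
        (@GoodLocalFrobenioid.toBase p k _ (GaloisValDatum.normVal k) (D.goodLocalFrobenioidOfEmb p k ι hX)) ∧
      CatIsomorphism.UnderUnique
        (@GoodLocalFrobenioid.toBase p k _ (GaloisValDatum.normVal k) (D.goodLocalFrobenioidOfEmb p k ι hX))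
        (@GoodLocalFrobenioid.toBase p k _ (GaloisValDatum.normVal k) (D.goodLocalFrobenioidOfEmb p k ι hX)) := by
  letI := GaloisValDatum.normVal k
  haveI := GaloisValDatum.charZero p k
  haveI : CompactSpace (D.PiLoc D.PiXarrow (localToGF F k ι)) :=
    D.compactSpace_PiLoc D.PiXarrow (localToGF F k ι) hX (continuous_localToGF F k ι)
  exact GoodLocalFrobenioid.hasUnder_and_underUnique_toBase_ofGalois_of_isSlimGroup (GaloisValDatum.ofComplete p k)
    _ _ _ _ k (GaloisValDatum.p_mem_normVal p k) (GaloisValDatum.ofComplete p k) _ _ _ _ k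
    (GaloisValDatum.p_mem_normVal p k) (D.isSlimGroup_PiLoc_PiXarrow_of_geom_slim p k hΔC ι hX)
    (D.isSlimGroup_PiLoc_PiXarrow_of_geom_slim p k hΔC ι hX)

end InitialThetaData

end Datum

section Place

variable {F : Type u} {K : Type} {Fbar : Type} [Field F] [NumberField F] [Field K] [NumberField K]
  [Algebra F K] [Field Fbar] [Algebra F Fbar] [Algebra K Fbar] [IsScalarTower F K Fbar] [Normal K Fbar]
  {E : WeierstrassCurve F} [E.IsElliptic] {l : ℕ} {Pb : BadPlacePredicates K}
  (D : InitialThetaData F K Fbar E l Pb) (w : HeightOneSpectrum (𝓞 K)) (p : ℕ) [Fact p.Prime]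
  (hw : ((p : ℕ) : 𝓞 K) ∈ w.asIdeal)

namespace InitialThetaData

/-- **Both binders of the natural map `Aut(𝒞_v̲) → Aut(𝒟_v̲)` ((c), `toBase`) AT THE PLACE `v̲ = w ∣ p`**
(`goodLocalFrobenioidAt`, `K_v̲ := K_w`), modulo ONLY the slimness of `Δ_C` (`hΔC`, FACT F-0004 first conjunct).
([IUTchI] Ex 3.3 (iii) (c) p.79) [claim: Mochizuki2012, status: disputed] -/
theorem hasUnder_and_underUnique_toBase_goodLocalFrobenioidAt (hX : IsOpen (D.PiXarrow : Set D.PiC))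
    (hΔC : IsSlimGroup D.DeltaC) :
    CatIsomorphism.HasUnder
        (@GoodLocalFrobenioid.toBase p (RescaledCompletion K p w hw) _
          (GaloisValDatum.normVal (RescaledCompletion K p w hw)) (D.goodLocalFrobenioidAt w p hw hX))
        (@GoodLocalFrobenioid.toBase p (RescaledCompletion K p w hw) _
          (GaloisValDatum.normVal (RescaledCompletion K p w hw)) (D.goodLocalFrobenioidAt w p hw hX)) ∧
      CatIsomorphism.UnderUnique
        (@GoodLocalFrobenioid.toBase p (RescaledCompletion K p w hw) _
          (GaloisValDatum.normVal (RescaledCompletion K p w hw)) (D.goodLocalFrobenioidAt w p hw hX))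
        (@GoodLocalFrobenioid.toBase p (RescaledCompletion K p w hw) _
          (GaloisValDatum.normVal (RescaledCompletion K p w hw)) (D.goodLocalFrobenioidAt w p hw hX)) := by
  letI : Algebra K (RescaledCompletion K p w hw) := inferInstanceAs (Algebra K (w.adicCompletion K))
  haveI := GaloisValDatum.finiteDimensional_rescaledCompletion K p w hw
  exact D.hasUnder_and_underUnique_toBase_goodLocalFrobenioidOfEmb p (RescaledCompletion K p w hw)
    (localEmb (K := K) (Fbar := Fbar) (AlgebraicClosure (RescaledCompletion K p w hw))) hX hΔC

/-- **[IUTchI] Ex. 3.3 (iii) (c) AS A KIND FUNCTOR AT THE PLACE `v̲ = w ∣ p`**: `ℱ̲_v̲ = 𝒞_v̲ ↦ 𝒟_v̲` on one-object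
kinds (abc-iut-L5-t4's `kindFunctor` — our §0 reading of (c) as the induced homomorphism `Aut(ℱ̲_v) → Aut(𝒟_v)`; the
phrase "the natural homomorphism `Aut(ℱ̲_v) → Aut(𝒟_v)`" is print's at Cor. 5.3 (iv) p. 144 l. 22–23, for `v ∈ 𝕍^bad`, not
at Ex. 3.3), modulo `hΔC` only — the slot `baseFullOf v` of t2's `HodgeTheaterModel` in design F1.  (Doc-only revision:
referee finding M26-F2; statements and proofs are byte-identical to the first landing.) ([IUTchI] Ex 3.3 (iii) (c) p.79) [claim: Mochizuki2012, status: disputed] -/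
def toBaseKindFunctorAt (hX : IsOpen (D.PiXarrow : Set D.PiC)) (hΔC : IsSlimGroup D.DeltaC) :
    SingleObj (CatAut (@GoodLocalFrobenioid.Cv p (RescaledCompletion K p w hw) _
        (GaloisValDatum.normVal (RescaledCompletion K p w hw)) (D.goodLocalFrobenioidAt w p hw hX))) ⥤
      SingleObj (CatAut (@GoodLocalFrobenioid.Dv p (RescaledCompletion K p w hw) _
        (GaloisValDatum.normVal (RescaledCompletion K p w hw)) (D.goodLocalFrobenioidAt w p hw hX))) :=
  CatIsomorphism.kindFunctor (D.hasUnder_and_underUnique_toBase_goodLocalFrobenioidAt w p hw hX hΔC).1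
    (D.hasUnder_and_underUnique_toBase_goodLocalFrobenioidAt w p hw hX hΔC).2

/-- **abc-iut-L5-t2's LAW `baseCompat v` AT THE GENUINE GOOD PLACE `v̲ = w ∣ p`** (design F1): the composite kind
functors `𝒞_v̲ ↦ 𝒟_v̲ ↦ 𝒟⊢_v̲` ((c) then (a)) and `𝒞_v̲ ↦ 𝒞⊢_v̲ ↦ 𝒟⊢_v̲` ((d) then (b)) of the datum
`goodLocalFrobenioidAt` are naturally isomorphic, GIVEN the Galois-countability of `Π_{C_F}`, the datum's openness `hX`
(Def. 3.1 (f)), `Δ_C` slim (`hΔC`, FACT F-0004 first conjunct) and [AbsAnab] Lem. 1.3.8 in the shape `hΔ` (FACT F-0007)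
— the union of the binders of the four kind functors, nothing more. ([IUTchI] Ex 3.3 (iii) p.79) [claim: Mochizuki2012, status: disputed] -/
def baseCompatAt [SecondCountableTopology D.PiC] (hX : IsOpen (D.PiXarrow : Set D.PiC))
    (hΔC : IsSlimGroup D.DeltaC)
    (hΔ : letI : Algebra K (RescaledCompletion K p w hw) := inferInstanceAs (Algebra K (w.adicCompletion K))
      ∀ φ : D.PiLoc D.PiXarrow (localToGF F (RescaledCompletion K p w hw)
          (localEmb (K := K) (Fbar := Fbar) (AlgebraicClosure (RescaledCompletion K p w hw)))) ≃ₜ*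
        D.PiLoc D.PiXarrow (localToGF F (RescaledCompletion K p w hw)
          (localEmb (K := K) (Fbar := Fbar) (AlgebraicClosure (RescaledCompletion K p w hw)))),
      (D.augLoc D.PiXarrow (localToGF F (RescaledCompletion K p w hw)
          (localEmb (K := K) (Fbar := Fbar) (AlgebraicClosure (RescaledCompletion K p w hw))))).ker.map
          φ.toMulEquiv.toMonoidHom =
        (D.augLoc D.PiXarrow (localToGF F (RescaledCompletion K p w hw)
          (localEmb (K := K) (Fbar := Fbar) (AlgebraicClosure (RescaledCompletion K p w hw))))).ker) :
    D.toBaseKindFunctorAt w p hw hX hΔC ⋙ D.ddashKindFunctorAt w p hw hX hΔ ≅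
      D.cdashKindFunctorAt w p hw hX hΔC hΔ ⋙ D.cdashBaseKindFunctorAt w p hw hX :=
  @GoodLocalFrobenioid.baseCompatKindFunctors p (RescaledCompletion K p w hw) _
    (GaloisValDatum.normVal (RescaledCompletion K p w hw)) (D.goodLocalFrobenioidAt w p hw hX)
    (D.hasUnder_and_underUnique_toBase_goodLocalFrobenioidAt w p hw hX hΔC).1
    (D.hasUnder_and_underUnique_toBase_goodLocalFrobenioidAt w p hw hX hΔC).2
    (D.ddashFromD_goodLocalFrobenioidAt_of_forall_map_ker w p hw hX hΔ)
    (D.cdashFromF_goodLocalFrobenioidAt w p hw hX hΔC hΔ) (D.liftUnique_cdashToC_goodLocalFrobenioidAt w p hw hX)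
    (D.hasUnder_and_underUnique_cdashBase_goodLocalFrobenioidAt w p hw hX).1
    (D.hasUnder_and_underUnique_cdashBase_goodLocalFrobenioidAt w p hw hX).2

end InitialThetaData

end Place

end Literature.IUT.HodgeTheaters

end
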